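import Mathlib
import HarnessLib
import HarnessLib.Audit
import Summits.CriticalPhenomena.Statement
import Literature.Probability.RandomPlanarGeometry.SLEConvergenceCriterion
import Literature.Probability.RandomPlanarGeometry.CurveTortuosity
import Literature.Topology.PlaneTopology.WindingNumber
import HarnessLib.Audit.Status.Attr

/-!
Route: SAWLeftRightFKG

DORMANT since 2026-08-26T09:40:16Z (reconciler: no traction for 8.4 d (last activity item-evidence-added at 2026-08-18T00:32:30Z); parked, not closed — `ledger route dormant route-CriticalPhenomena-SAWLeftRightFKG --off` to reactivate) — unstaffed, not closed; items shared with open routes are served there. `ledger route dormant <id> --off` reactivates.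

It suffices to show X_FKG = (PA) ∧ (PA ⇒ AB) ∧ (I)  [route realising idea card hex-saw-leftright-fkg
— "an FKG inequality for polymers that switches on at criticality"]:
 (PA) LeftRightFKG: the critical square-lattice SAW chord measure w(γ) = x_c^{|γ|}
(Literature.Probability.RandomPlanarGeometry.SAW.weight) in a simply connected discrete domain (the
lattice points enclosed by a closed lattice walk C: Ω = {z | wind(C, z) ≠ 0}, slits allowed),
between endpoints a, b adjacent to C, is POSITIVELY ASSOCIATED for the left–right order γ₁ ≼ γ₂ :⟺
the lens loop γ₁·γ₂⁻¹ has winding ≥ 0 everywhere (= nesting of the right regions; winding number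
Literature.Topology.PlaneTopology.wind of the mesh polyline SimpleGraph.Walk.toCurve extended by
Set.IccExtend — literally the definiens of Literature.Probability.RandomPlanarGeometry.Curve.wind):
w(A)·w(B) ≤ w(all)·w(A ∩ B) for ≼-up-closed A, B;
 (PA ⇒ AB) FKGToTraversalBound: from (PA) — plus lattice symmetry and Kesten's bridge-mass identity
at x_c — a one-curve Russo–Seymour–Welsh scheme gives the Aizenman–Burchard hypothesis (H1) for the
critical SAW: for every Dobrushin domain and endpoint approximation
(Literature.Probability.RandomPlanarGeometry.SAW.IsEndpointApprox) there are k, K, λ > 2, δ₀ with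
Literature.Probability.RandomPlanarGeometry.SAW.law(k(x,ρ,R) separate traversals of the shell
D(x;ρ,R), Literature.Probability.RandomPlanarGeometry.Curve.HasTraversals) ≤ K(ρ/R)^λ for δ ≤ δ₀, δ
≤ ρ < R ≤ 1;
 (I) SubseqIdentification (shared verbatim with route SAWParafermion, stmt-CriticalPhenomena-0783):
every subsequential weak limit of the SAW laws is the chordal SLE_{8/3} law
(Literature.Probability.RandomPlanarGeometry.IsSLELaw (8/3)).
Then: (PA ⇒ AB)(PA) feeds the tree's PROVED Aizenman–Burchard criterion
Literature.Probability.RandomPlanarGeometry.isTightMeasureSet_of_traversalBounds (support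
TraversalBoundTight: SAWTraversalBound → EventualTight, eventual tightness
Literature.Probability.RandomPlanarGeometry.IsTightAlongMesh — NOT the refuted all-δ form
stmt-CriticalPhenomena-0772), and
Literature.Probability.RandomPlanarGeometry.convergesInLawToSLE_of_isTightAlongMesh with the PROVED
uniqueness Literature.Probability.RandomPlanarGeometry.IsSLECurve.map_eq_holds and (I) gives
Literature.Probability.RandomPlanarGeometry.SAW.SAWScalingLimit = SAWScalingLimit (item Assembly,
the Prokhorov glue).
Lean (decls of the route file): Assembly := LeftRightFKG → FKGToTraversalBound → TraversalBoundTight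
→ SubseqIdentification → SAWScalingLimit, with FKGToTraversalBound ↔ (LeftRightFKG →
SAWTraversalBound) by Iff.rfl; deciding theorem closes : LeftRightFKG → FKGToTraversalBound →
TraversalBoundTight → SubseqIdentification → Assembly → SAWScalingLimit := fun h₁ h₂ h₃ h₄ hA => hA
h₁ h₂ h₃ h₄. The route file imports only fact-free modules (SLEConvergenceCriterion,
CurveTortuosity, Topology.PlaneTopology.WindingNumber): no unproved named fact enters through this
route's own imports (repair 2026-08-15).

Rationale: WHY THIS LINE. Every route of this sub-problem stalls on precompactness: the all-δ Tight
(stmt-CriticalPhenomena-0772) is refuted, and its eventual form is open because the critical SAW has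
"no FKG, no Markov property, no RSW" (SAWParafermion KSConditionG2 why-might-fail;
KemppainenSmirnov2017 §4 verifies Condition G2 only where FKG is available; MadrasSlade1993 p.131
records FKG's absence). The card hex-saw-leftright-fkg observes that in the LEFT–RIGHT order of
chords the x^{|γ|} weights DO satisfy the FKG lattice condition on trivalent planar lattices
(envelopes are SAWs; length is submodular), that only distributivity is missing, and that exact
enumeration shows positive association (PA) at and below x_c and its failure supercritically
(consistent with DuminilCopinKozmaYadin2014): "an FKG inequality for polymers that switches on at
criticality". Area imported: correlation inequalities (FortuinKasteleynGinibre1971, Holley1974,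
Harris1960 monotone Markov chains; Strassen couplings) + the RSW/Aizenman–Burchard precompactness
technology (AizenmanBurchardDuke1999, KemppainenSmirnov2017, KohlerSchindlerTassion2023) + Kesten's
renewal identity at x_c (Kesten1963SAW, MadrasSlade1993 (4.2.4): Σ_k λ_k μ^{-k} = 1, a_N ≤ 1) as the
symmetry/normalisation input replacing self-duality. New object posited: none beyond a partial order
on Literature.Probability.RandomPlanarGeometry.SAW.DomainSAW, typed intrinsically by lens-loop
winding (no definition request needed). The route targets the tree's PROVED AB criterion, so no
unproved named fact sits in the assembly cone (IsSLECurve.map_eq_holds is a theorem). REPAIR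
2026-08-15 (route-repair, cone guardrail + deciding theorem): the rev-0 file imported HexSAW.lean
and Barriers/…/SupercriticalSAWSpaceFilling.lean for three non-load-bearing items and thereby
carried the UNPROVABLE debts HexSAWScalingLimit (open conjecture) and DKY2014_problem10_disk (open
problem) plus DuminilCopinSmirnov2012_thm1, RobustSAWScalingLimit (refuted) etc. into its cone; and
LoopWinding.lean (for Curve.wind) carried LoopSpace.completeSpace. Rerouted: imports are now the
fact-free SLEConvergenceCriterion, CurveTortuosity, Topology.PlaneTopology.WindingNumber;
HexLeftRightFKG / HexEnvelopeLattice dropped from THIS route (the honeycomb model case is recorded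
on card hex-saw-leftright-fkg and belongs to a Hex-lattice tightness route); LeftRightFKG restated
with Curve.wind unfolded to PlaneTopology.wind ∘ Set.IccExtend (Iff.rfl-equivalent to rev 0);
NotFKGAtOne restated over Mathlib's counting measure (weightAt 1 = Measure.count); closes proved
(fun h₁ h₂ h₃ h₄ hA => hA h₁ h₂ h₃ h₄). needs-fact: none.
RANKED CRUXES (decls):
 r2 LeftRightFKG (typed): PA at x_c on δℤ² in every simply connected discrete domain Ω = {wind(C,·)
≠ 0} (C a closed lattice walk, slits allowed) between endpoints adjacent to C, event form w(A)w(B) ≤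
w(all)w(A∩B) for up-closed A, B. Hardest and most informative; dies on ONE certified counterexample
(μ ∈ [2.6, 2.695] is proved in tree, so x_c-inequalities are decidable by interval arithmetic).
Refuter evidence so far (route review 729bda87): exhaustive all-up-set PA clean at x_c on 8
irregular domains; onset threshold x₀(L) ≈ x_c + 0.45/L — no asymptotic margin, first failures at
marked points.
 r3 FKGToTraversalBound (typed, = LeftRightFKG → SAWTraversalBound by Iff.rfl): the one-curve RSW
engine — PA-monotonicity in slit domains + D₄ symmetry + Kesten's u_T ≤ 1 ⇒ unforced annulus
crossings ≤ 1−ε uniformly ⇒ iterated through domain Markov ⇒ AB (H1) with λ(k) → ∞; endpoint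
bookkeeping as in Percolation.bondExploration_traversalBound (shell-dependent threshold k).
 r4 SubseqIdentification (typed; verbatim SAWParafermion r3, shared item): identification is NOT
this route's mechanism; staffed through the routes that own it.
SUPPORT: SAWTraversalBound (standalone (H1), shareable with any tightness route); EventualTight
(IsTightAlongMesh — the repaired Tight); TraversalBoundTight (AB criterion + short-distance cutoff
for SAW polylines + bridge isTightAlongMesh_of_isTightMeasureSet_image); NotFKGAtOne (PA fails for
the counting measure = fugacity 1 on ℤ², finite certificate; DKY guard); Assembly (the Prokhorov
glue, below).
ASSEMBLY: LeftRightFKG → FKGToTraversalBound → TraversalBoundTight → SubseqIdentification →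
SAWScalingLimit (laws are eventually probability measures by IsEndpointApprox.reachable + finiteness
of DomainSAW via meshDomain_finite; Prokhorov criterion convergesInLawToSLE_of_isTightAlongMesh with
huniq := IsSLECurve.map_eq_holds, hY := SAW.aemeasurable_curve); deciding theorem closes := fun h₁
h₂ h₃ h₄ hA => hA h₁ h₂ h₃ h₄.
KILL CRITERIA: ¬LeftRightFKG by a certified negative covariance AT x_c (not merely at x = 1) closes
the route unless the witness is microscopic at the marked points, in which case the tenure repair is
the hull-avoidance sub-family (same-side excisions only — the form r3 actually consumes);
¬SAWTraversalBound refutes eventual tightness and hence the conjunct for that approximation (all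
routes); refutation of r4 kills the conjunct.
NOT DECOMPOSED YET: the RSW scheme inside r3 (which annuli, how Kesten's identity yields ε > 0 on ℤ²
where u_T ≤ 1 is not < 1; Hex has B_T → 0 by DuminilCopinSmirnov2012/GlazmanManolescu2019); the
weaker SAME-SIDE HULL-AVOIDANCE form of PA that r3 consumes (refuter 729bda87 recommends filing it
as a shared item — first tenure move, and the repair target if r2 dies at marked points); the
honeycomb model case (PA for hexSAWWeight on δℍ, where the envelope lattice condition |m|+|j| ≤
|γ₁|+|γ₂| is a theorem — card hex-saw-leftright-fkg; dropped from this route's items 2026-08-15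
because HexSAW.lean carries the open HexSAWScalingLimit into the cone; to be filed on a Hex-lattice
route); ℤ² lattice structure (kissing corners: chords on ℤ² need not have a lub — deliberately NOT
filed as a statement); by-products of PA (existence of the boundary-avoidance exponent by Fekete,
monotone wedge/slit-plane SAW limits, Loewner regularity via KS G2); interior endpoints of
IsEndpointApprox (first-step domain-Markov reduction inside r3).
CHEAPEST FALSIFIER. Exact enumeration of the two side-event (same-arc hull-avoidance) covariances
for corner-to-corner chords of an L×L-face box at x = x_c ∈ [10/27, 10/26] with interval arithmetic,
L = 4…7, then slit domains with endpoints flanking the slit tip: one certified negative covariance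
at x_c is ¬LeftRightFKG. Run so far (card + refuter 729bda87): clean at x_c up to 6×6 vertices
(1.26M chords) and on 8 irregular/slit domains; fails at x = 1 (NotFKGAtOne).
Sources: FortuinKasteleynGinibre1971, Holley1974, Harris1960, KemppainenSmirnov2017
(arXiv:1212.6215), AizenmanBurchardDuke1999, KohlerSchindlerTassion2023, Kesten1963SAW,
MadrasSlade1993, DuminilCopinSmirnov2012, DuminilCopinKozmaYadin2014,
LawlerSchrammWerner2003Restriction, arXiv:math/0307353, arXiv:2407.13871, arXiv:2310.17299,
arXiv:1707.09335, CamiaNewman2007.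

Novelty: NOVELTY. Delta: the LEFT–RIGHT order on undirected self-avoiding chords (non-distributive poset; on
trivalent lattices a lattice with submodular length |γ∧γ'|+|γ∨γ'| ≤ |γ|+|γ'| = the FKG lattice
condition for x^{|γ|}, x ≤ 1), the conjecture that association holds at x_c and fails
supercritically (enumeration data in card hex-saw-leftright-fkg and its ℤ² companions), and its use
as the missing third leg (association + lattice symmetry + Kesten's exact bridge-mass conservation
MadrasSlade1993 eq. (4.2.4)) of a ONE-CURVE RSW scheme feeding Aizenman–Burchard tightness. Nearest
prior art: (1) FKG/Holley on DISTRIBUTIVE lattices (FortuinKasteleynGinibre1971, Holley1974,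
Ahlswede–Daykin 1978) and FKG for paths in the POINTWISE order (Barbato 2005 for Brownian motion;
Legrand arXiv:2407.13871 for Lévy/Bessel/conditioned Markov chains); (2) association ⇒ RSW ⇒
precompactness templates KemppainenSmirnov2017 §4 (arXiv:1212.6215v3 p.21: "the FKG inequality which
is needed when verifying Condition G2", FK/percolation only), KohlerSchindlerTassion2023,
AizenmanBurchardDuke1999 App. A; (3) continuum consistency LawlerSchrammWerner2003Restriction (Φ'
cocycle), Werner arXiv:math/0307353 Thm 8 (Poisson excursion cloud ⇒ Harris–FKG for same-side
SLE_{8/3} events); (4) the printed consensus that SAW has NO FKG: MadrasSlade1993 Notes to §4.1 (pdf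
p.131, read: "In place of the FKG inequality … we require Lemma 4.1.4"), route SAWParafermion item
KSConditionG2 why-might-fail. None of (1)–(4) orders  [refs: 2407.13871, 1212.6215, math/0307353, 2310.17299, MadrasSlade1993, FortuinKasteleynGinibre1971, Holley1974, KemppainenSmirnov2017, KohlerSchindlerTassion2023, AizenmanBurchardDuke1999]

Barriers (technique_class: left-right-association one-curve-rsw precompactness-only): BARRIERS (technique_class: left-right-association one-curve-rsw precompactness-only; catalogue
Literature/Barriers/CriticalPhenomena/*, decls checked):
- Literature.Barriers.CriticalPhenomena.SupercriticalSAWSpaceFilling (DKY2014_thm1): RESPECTED as a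
guard — PA is claimed at x = x_c only (support NotFKGAtOne records that it FAILS at x = 1; card
data: fails for x ≳ 0.5–0.7 on small boxes); nothing here is an open condition in x,
RobustSAWScalingLimit is not entailed.
- Literature.Barriers.CriticalPhenomena.EmbeddingModulusUniqueness: an association/RSW argument is
embedding-blind and shear-invariant, so it can never produce conformal or rotational invariance —
EVADED BY SCOPE: the route delivers precompactness (EventualTight) only and imports identification
(SubseqIdentification) from embedding-sensitive routes (SAWParafermion / SAWConfRestriction /
SAWHexUniversality); honest residue: without (I) the route proves tightness + existence of
subsequential limits, not the conjunct.
- Literature.Barriers.CriticalPhenomena.SAWNotKineticallyGrown: no growth rule or locality is used;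
only the configurational x_c^{|γ|} law and its exact slit-domain conditioning (domain Markov
property of the two-point measure).
- Literature.Barriers.CriticalPhenomena.NienhuisWeightsExcludeVertexSAW and
Literature.Barriers.CriticalPhenomena.ParafermionicHalfCauchyRiemann: no observable and no local
linear relation appear; does not apply.
- Literature.Barriers.CriticalPhenomena.TransverseCrossingsNeedNo

Novelty grade: new-combination — ROUTE REVIEW (refuter 729bda87, 3rd pass after 0dd483c9/c2488848). 10/10 decls rc0 (W_saw.lean); the two glue items are Iff.rfl; summit abbrev = Literature SAWScalingLimit (rfl). Negative stmt-0772 (all-delta Tight) is REPAIRED (EventualTight = IsTightAlongMesh), not recombined; the AB criterion con (refuter refuter-rreview-route-CriticalPhenomena--729bda87-0, 2026-08-15T13:52:25Z; prior: arXiv:1707.09335 DGPS Prop 8 (left-right PA of the O(n) interface, n>=1; PA=>RSW), arXiv:1212.6215 KemppainenSmirnov §4 (FKG+RSW => G2), arXiv:2011.04618 KST (PA => RSW), FKG1971 doi:10.1007/bf01651330 / Holley1974, AizenmanBurchardDuke1999 (tree AB criterion PROVED), MadrasSlade1993 p.131, eq.(4.2.4), mechcritic 2271-0 grade of card hex-s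aw-leftright-fkg)

History (route lifecycle, newest last):
- 2026-08-15T16:53:58Z · rev 1: restated LeftRightFKG (stmt-CriticalPhenomena-1877), NotFKGAtOne (stmt-CriticalPhenomena-1884) — route-repair (cone guardrail + glue.missing): imports 5→3 fact-free (drop HexSAW, Barriers.SupercriticalSAWSpaceFilling, LoopWinding; add Topology.PlaneTopology (planner-rbadge-CriticalPhenomena-SAWLeftRightF-72cbc6df-g4-0)
- 2026-08-15T16:53:58Z · rev 1: dropped HexLeftRightFKG, HexEnvelopeLattice — route-repair (cone guardrail + glue.missing): imports 5→3 fact-free (drop HexSAW, Barriers.SupercriticalSAWSpaceFilling, LoopWinding; add Topology.PlaneTopology (planner-rbadge-CriticalPhenomena-SAWLeftRightF-72cbc6df-g4-0)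
- 2026-08-16T02:17:39Z · AUTO-CRUX: 1 conjecture-grade item(s) promoted to crux (NotFKGAtOne) — refuter vetting / tiering apply (operator:999:1362873)
- 2026-08-26T09:40:16Z · DORMANT — reconciler: no traction for 8.4 d (last activity item-evidence-added at 2026-08-18T00:32:30Z); parked, not closed — `ledger route dormant route-CriticalPhenomen (operator:999:1020186)

sub-problem: SAWScalingLimit · status: dormant · opened planner-plancard-CriticalPhenomena-SAWScaling-99807a93-0 2026-08-15T10:59:21Z · rev 2 · ledger route-CriticalPhenomena-SAWLeftRightFKG
GENERATED by the gate from the ledger (D-0016/17). Provers cite these decls: `theorem foo : Summit.CriticalPhenomena.SAWScalingLimit.Theses.SAWLeftRightFKG.<Decl> := …` in Summits/CriticalPhenomena/SAWScalingLimit/Theorems/<Name>.lean.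
-/

namespace Summit.CriticalPhenomena.SAWScalingLimit.Theses.SAWLeftRightFKG

open scoped BigOperators Topology Manifold Classical MeasureTheory ProbabilityTheory Matrix InnerProductSpace ComplexConjugate ContinuousMap
open Filter Set Function TopologicalSpace MeasureTheory

attribute [summit_statement] _root_.SAWScalingLimit

-- earlier LeftRightFKG (stmt-CriticalPhenomena-1877, replaced 2026-08-15T16:53:58Z -> stmt-CriticalPhenomena-11232): retired by None — ∀ (δ : ℝ) (c a b a' b' : Literature.Probability.LatticeModels.Site 2) (C : (Literature.Probability.LatticeModels.zdGraph 2).Walk c c), let Ω : Set ℂ := {z | Literature.Probability.RandomPlanarGeometry.Curve.wind ⟨C.toCurve (Literature.Probability.LatticeModels.meshPo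
/-- item stmt-CriticalPhenomena-11232 · crux · rank 2 · open · by planner
why it might fail: Chord poset on ℤ² is neither distributive nor a lattice (kissing corners); PA FAILS at x=1 and the finite-size onset x₀(L)≈x_c+0.45/L (.53/.486/.462 at L=3,4,5) leaves no asymptotic margin at x_c≈.379: one certified negative covariance at x_c (likeliest at the marked points) refutes it.
sources: FortuinKasteleynGinibre1971 (lattice condition ⇒ association on DISTRIBUTIVE lattices only), Holley1974, MadrasSlade1993 (Notes to §4.1, pdf p.131: no FKG for SAW; eq. (4.2.4)), DuminilCopinKozmaYadin2014 (Thm 1: supercritical space filling — PA must fail for x>x_c), Summits/CriticalPhenomena/SAWScalingLimit/Ideas/hex-saw-leftright-fkg.md (enumeration: PA for x≤0.7 on brick 5×6…6×8, fails x→1), Summits/CriticalPhenomena/SAWScalingLimit/Ideas/fkg-z2-threshold-evidence.md (Z² thresholds, same-arc ratio ≥1.020 at x_c on 6×5)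
[crux] r2 (hardest, most informative): LEFT–RIGHT FKG of the critical square-lattice SAW. Typed
intrinsically: C a closed walk of ℤ² (the boundary; slits allowed), Ω := {z : wind(δ-polyline of C,
z) ≠ 0} (components simply connected; vertices on C excluded since wind is junk 0 on the trace),
endpoints a, b lattice-adjacent to C (chordal case), chords γ : SAW.DomainSAW Ω δ a b, weight w =
x_c^{|γ|} (SAW.weight). ORDER γ₁ ≼ γ₂ :⟺ ∀ z, 0 ≤ wind(lens loop γ₁·γ₂⁻¹, z) = nesting of the right
regions (Jordan argument with an exterior reference arc; PA is invariant under order reversal). Here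
wind = Literature.Topology.PlaneTopology.wind of the Set.IccExtend'ed mesh polyline
SimpleGraph.Walk.toCurve — the definiens of Literature.Probability.RandomPlanarGeometry.Curve.wind,
written out (repair 2026-08-15, Iff.rfl-equivalent to the rev-0 decl) so that the route file imports
no fact-carrying module. CLAIM (event form ⟺ E[fg]E[1] ≥ E[f]E[g] for monotone f, g): w(A)w(B) ≤
w(univ)w(A∩B) for ≼-up-closed A, B. Consequences: same-side hull avoidances positively correlated;
domain monotonicity P_{Ω∖H} ≼ P_Ω (exact restriction). Evidence: card (brick lattice, PA for x ≤
0.7, fails at 1), fkg-z2-thres -/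
@[route_item "route-CriticalPhenomena-SAWLeftRightFKG", crux]
def LeftRightFKG : Prop :=
  ∀ (δ : ℝ) (c a b a' b' : Literature.Probability.LatticeModels.Site 2) (C : (Literature.Probability.LatticeModels.zdGraph 2).Walk c c), let Ω : Set ℂ := {z | Literature.Topology.PlaneTopology.wind (fun t : ℝ => Set.IccExtend zero_le_one (C.toCurve (Literature.Probability.LatticeModels.meshPoint δ)) t - z) ≠ 0}; let le : Literature.Probability.RandomPlanarGeometry.SAW.DomainSAW Ω δ a b → Literature.Probability.RandomPlanarGeometry.SAW.DomainSAW Ω δ a b → Prop := fun γ₁ γ₂ => ∀ z : ℂ, 0 ≤ Literature.Topology.PlaneTopology.wind (fun t : ℝ => Set.IccExtend zero_le_one ((γ₁.walk.append γ₂.walk.reverse).toCurve (Literature.Probability.LatticeModels.meshPoint δ)) t - z); 0 < δ → a' ∈ C.support → b' ∈ C.support → (Literature.Probability.LatticeModels.zdGraph 2).Adj a a' → (Literature.Probability.LatticeModels.zdGraph 2).Adj b b' → ∀ A B : Set (Literature.Probability.RandomPlanarGeometry.SAW.DomainSAW Ω δ a b), (∀ γ₁ γ₂, le γ₁ γ₂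 → γ₁ ∈ A → γ₂ ∈ A) → (∀ γ₁ γ₂, le γ₁ γ₂ → γ₁ ∈ B → γ₂ ∈ B) → Literature.Probability.RandomPlanarGeometry.SAW.weight Ω δ a b A * Literature.Probability.RandomPlanarGeometry.SAW.weight Ω δ a b B ≤ Literature.Probability.RandomPlanarGeometry.SAW.weight Ω δ a b Set.univ * Literature.Probability.RandomPlanarGeometry.SAW.weight Ω δ a b (A ∩ B)

/-- item stmt-CriticalPhenomena-1878 · crux · rank 3 · open · by planner
why it might fail: No square-root trick (reflection reverses ≼), so ε>0 for 'unforced crossing ≤1−ε' must come from Kesten's bridge mass u_T≤1 (not <1 on Z²) + PA-monotonicity in slit domains; interior endpoints allowed by IsEndpointApprox and the λ>2 multi-traversal iteration near ∂Ω are untested.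
sources: KemppainenSmirnov2017 (arXiv:1212.6215v3: Condition G2 §2.1.3; §4 p.21 G2 via FKG+RSW for FK/percolation; Thm 1.3 = journal Thm 1.5), AizenmanBurchardDuke1999 ((1.3) hypothesis H1; Appendix A Thm A.1), KohlerSchindlerTassion2023 (RSW from symmetry + positive association), Kesten1963SAW + MadrasSlade1993 eq. (4.2.4) (Σ_k λ_k μ^{-k} = 1, a_N = b_N μ^{-N} ≤ 1), DuminilCopinSmirnov2012 (B_T(x_c) → 0 on Hex) / GlazmanManolescu2019 Thm 2, Literature.Probability.Percolation.bondExploration_traversalBound (typed template; InterfaceTraversalBound.lean proof pattern)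
[crux] r3: the ONE-CURVE RSW ENGINE as the implication LeftRightFKG → SAWTraversalBound (conclusion
inlined; Iff with the support decl is rfl): per Dobrushin domain and endpoint approximation a
shell-dependent threshold k(x,ρ,R), K, λ > 2, δ₀ with P_δ(k(x,ρ,R) separate traversals of D(x;ρ,R))
≤ K(ρ/R)^λ for δ ≤ δ₀, δ ≤ ρ < R ≤ 1. Scheme: (i) domain Markov — the future after the j-th
traversal is an x_c-SAW in the slit domain from a boundary-adjacent tip, exactly r2's setting; (ii)
PA ⇒ monotone comparison with chords of standard half-annuli/rectangles and positive correlation of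
same-side avoidances = RSW gluing for ONE curve without independence; (iii) the ε: unforced
crossings of A(z; r, 2r) cost a uniform price by Kesten's conservation of irreducible-bridge mass at
x_c (MadrasSlade1993 (4.2.4): u_T ≤ 1 on Z²; Hex: B_T → 0) + D₄ symmetry — no square-root trick
(reflection reverses ≼); (iv) iterate for λ(k) → ∞; forced crossings near marked points/fjords go
into k(x,ρ,R) as in Percolation.bondExploration_traversalBound. Interior endpoints: condition on the
first step (tip then adjacent to the removed past). -/
@[route_item "route-CriticalPhenomena-SAWLeftRightFKG", crux]
def FKGToTraversalBound : Prop :=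
  LeftRightFKG → ∀ (D : Literature.Probability.RandomPlanarGeometry.DobrushinDomain) (a b : ℝ → Literature.Probability.LatticeModels.Site 2), Literature.Probability.RandomPlanarGeometry.SAW.IsEndpointApprox D a b → ∃ (k : ℂ → ℝ → ℝ → ℕ) (K lam δ₀ : ℝ), 0 ≤ K ∧ 2 < lam ∧ 0 < δ₀ ∧ ∀ δ ∈ Set.Ioc (0 : ℝ) δ₀, ∀ (x : ℂ) (ρ R : ℝ), δ ≤ ρ → ρ < R → R ≤ 1 → Literature.Probability.RandomPlanarGeometry.SAW.law D.carrier δ (a δ) (b δ) {γ | (⟨γ.walk.toCurve (Literature.Probability.LatticeModels.meshPoint δ)⟩ : Literature.Probability.RandomPlanarGeometry.Curve ℂ).HasTraversals (k x ρ R) x ρ R} ≤ ENNReal.ofReal (K * (ρ / R) ^ lam)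

/-- item stmt-CriticalPhenomena-0783 · crux · rank 4 · open · by planner
why it might fail: Unconditional over arbitrary subsequential μ: SLE_{8/3} is known only IF the limit is conformally covariant (LSW04 Prediction 1); on Z² no embedding-sensitive input exists yet (observable open even on Hex); embedding-blind arguments (incl. this route's PA/RSW) cannot give rotations (Beffara2008).
sources: LawlerSchrammWerner2004SAW (arXiv:math/0204277 p.7; Prediction 1), LawlerSchrammWerner2003Restriction (Prop. 5.2: h_t'(W_t)^{5/8} local martingale iff κ=8/3), DuminilCopinSmirnov2012 (Conjecture 1–2), Beffara2008, Literature.Barriers.CriticalPhenomena.EmbeddingModulusUniqueness, route-CriticalPhenomena-SAWParafermion item stmt-CriticalPhenomena-0783 (same statement, shared)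
[crux] r3: identification of subsequential limits — for every Dobrushin domain D, endpoint
approximation (a_δ,b_δ), sequence s_n → 0+ and probability measure μ on CurveClass ℂ, if ∫ f∘curve
d(Literature.Probability.RandomPlanarGeometry.SAW.law D (s n) …) → ∫ f dμ for all bounded continuous
f then μ is the chordal SLE_{8/3} law in D (Literature.Probability.RandomPlanarGeometry.IsSLELaw
(8/3) D μ). Obtained from r2 (observable limit) by the martingale principle (LSW03
arXiv:math/0209343 Prop. 5.2: κ = 8/3 is singled out by the 5/8-observable), or from restriction
(sibling route). -/
@[route_item "route-CriticalPhenomena-SAWLeftRightFKG", crux]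
def SubseqIdentification : Prop :=
  ∀ (D : Literature.Probability.RandomPlanarGeometry.DobrushinDomain) (a b : ℝ → Literature.Probability.LatticeModels.Site 2), Literature.Probability.RandomPlanarGeometry.SAW.IsEndpointApprox D a b → ∀ (s : ℕ → ℝ) (μ : MeasureTheory.Measure (Literature.Probability.RandomPlanarGeometry.CurveClass ℂ)), Filter.Tendsto s Filter.atTop (nhdsWithin 0 (Set.Ioi 0)) → MeasureTheory.IsProbabilityMeasure μ → (∀ f : BoundedContinuousFunction (Literature.Probability.RandomPlanarGeometry.CurveClass ℂ) ℝ, Filter.Tendsto (fun n => ∫ γ, f γ.curve ∂(Literature.Probability.RandomPlanarGeometry.SAW.law D.carrier (s n) (a (s n)) (b (s n)))) Filter.atTop (nhds (∫ x, f x ∂μ))) → Literature.Probability.RandomPlanarGeometry.IsSLELaw ((8 : NNReal) / 3) D μ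

-- earlier NotFKGAtOne (stmt-CriticalPhenomena-1884, replaced 2026-08-15T16:53:58Z -> stmt-CriticalPhenomena-11233): retired by None — ¬ ∀ (δ : ℝ) (c a b a' b' : Literature.Probability.LatticeModels.Site 2) (C : (Literature.Probability.LatticeModels.zdGraph 2).Walk c c), let Ω : Set ℂ := {z | Literature.Probability.RandomPlanarGeometry.Curve.wind ⟨C.toCurve (Literature.Probability.LatticeModels.meshP
/-- item stmt-CriticalPhenomena-11233 · support (kind.auto-crux: conjecture-grade) · rank 9 · closed · proved by Summit.CriticalPhenomena.SAWScalingLimit.Theorems.NotFKGAtOne.notFKGAtOne @ 59ef317bb03a (prover) · by planner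
why it might fail: Expected TRUE and now certified: finite certificate on the 3×3 box (corner chords (0,0)→(2,2); A = first step N, B = last step E: 6·6 = 36 > 12·2 = 24), all three registered stubs landed sorry-free (Theorems/SAWLeftRightFKGNotFKGAtOne{WindBox,MeshBox,BoxCensus}.lean); closing theorem p85094.
sources: Summits/CriticalPhenomena/SAWScalingLimit/Theorems/SAWLeftRightFKGNotFKGAtOneBoxCensus.lean (census 12/6/6/2, kernel decide), Summits/CriticalPhenomena/SAWScalingLimit/Theorems/SAWLeftRightFKGNotFKGAtOneWindBox.lean, Summits/CriticalPhenomena/SAWScalingLimit/Theorems/SAWLeftRightFKGNotFKGAtOneMeshBox.lean, Summits/CriticalPhenomena/SAWScalingLimit/Cruxes/NotFKGAtOne/DrefuteLineComplete.lean (rc 0, 0 sorry: theorem notFKGAtOne), Summits/CriticalPhenomena/SAWScalingLimit/Ideas/hex-saw-leftright-fkg.md, DuminilCopinKozmaYadin2014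
[support] NEGATIVE GUARD 'switches on at criticality': the same left–right association statement
with the critical weight replaced by the fugacity-1 weight — the COUNTING measure
MeasureTheory.Measure.count on chords (=
Literature.Barriers.CriticalPhenomena.SupercriticalSAW.weightAt 1, the uniform measure; restated
2026-08-15 over Mathlib's Measure.count so that the barrier module and its open Problem 10 leave
this route's cone; equivalence weightAt 1 = Measure.count is one simp) is FALSE — some lattice
domain (C, a, b) and ≼-up-closed A, B have |A|·|B| > |univ|·|A∩B|. A finite computation (e.g.
corner-to-corner chords of a 4×4-face box with two side events); records that nobody should type FKG
for all x ≤ 1 and anchors the DKY barrier reading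
(Literature.Barriers.CriticalPhenomena.SupercriticalSAWSpaceFilling). -/
@[route_item "route-CriticalPhenomena-SAWLeftRightFKG"]
def NotFKGAtOne : Prop :=
  ¬ ∀ (δ : ℝ) (c a b a' b' : Literature.Probability.LatticeModels.Site 2) (C : (Literature.Probability.LatticeModels.zdGraph 2).Walk c c), let Ω : Set ℂ := {z | Literature.Topology.PlaneTopology.wind (fun t : ℝ => Set.IccExtend zero_le_one (C.toCurve (Literature.Probability.LatticeModels.meshPoint δ)) t - z) ≠ 0}; let le : Literature.Probability.RandomPlanarGeometry.SAW.DomainSAW Ω δ a b → Literature.Probability.RandomPlanarGeometry.SAW.DomainSAW Ω δ a b → Prop := fun γ₁ γ₂ => ∀ z : ℂ, 0 ≤ Literature.Topology.PlaneTopology.wind (fun t : ℝ => Set.IccExtend zero_le_one ((γ₁.walk.append γ₂.walk.reverse).toCurve (Literature.Probability.LatticeModels.meshPoint δ)) t - z); 0 < δ → a' ∈ C.support → b' ∈ C.support → (Literature.Probability.LatticeModels.zdGraph 2).Adj a a' → (Literature.Probability.LatticeModels.zdGraph 2).Adj b b' → ∀ A B : Set (Literature.Probability.RandomPlanarGeometry.SAW.DomainSAW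 Ω δ a b), (∀ γ₁ γ₂, le γ₁ γ₂ → γ₁ ∈ A → γ₂ ∈ A) → (∀ γ₁ γ₂, le γ₁ γ₂ → γ₁ ∈ B → γ₂ ∈ B) → MeasureTheory.Measure.count A * MeasureTheory.Measure.count B ≤ MeasureTheory.Measure.count (Set.univ : Set (Literature.Probability.RandomPlanarGeometry.SAW.DomainSAW Ω δ a b)) * MeasureTheory.Measure.count (A ∩ B)

-- `NotFKGAtOne` holds: proved by `Summit.CriticalPhenomena.SAWScalingLimit.Theorems.NotFKGAtOne.notFKGAtOne` @ 59ef317bb03a (its module imports this route file, so no `_holds` link can be stated here).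

/-- item stmt-CriticalPhenomena-1880 · support · rank 9 · open · by planner
why it might fail: Open: no annulus-crossing technology for x_c-SAW in print (sub-ballisticity DuminilCopinHammond2013 / arXiv:2310.17299 is the strongest input); typed for ALL IsEndpointApprox incl. interior endpoints.
sources: AizenmanBurchardDuke1999 ((1.3), App. A), KemppainenSmirnov2017, DuminilCopinHammond2013, arXiv:2310.17299, Literature.Probability.Percolation.bondExploration_traversalBound (template)
[support] the Aizenman–Burchard hypothesis (H1) for the critical square-lattice SAW, standalone form
of r3's conclusion (so that other tightness routes — e.g. card saw-rsw-from-kesten-renewal-tightness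
— can share it, and a direct proof by any method closes r3 too): for every Dobrushin domain D and
endpoint approximation (a_δ, b_δ) there exist a shell-dependent threshold k : ℂ → ℝ → ℝ → ℕ, K ≥ 0,
λ > 2, δ₀ > 0 such that for δ ∈ (0, δ₀] and δ ≤ ρ < R ≤ 1,
Literature.Probability.RandomPlanarGeometry.SAW.law D δ a_δ b_δ {γ : the mesh polyline of γ has
k(x,ρ,R) separate traversals of D(x;ρ,R)} ≤ K(ρ/R)^λ
(Literature.Probability.RandomPlanarGeometry.Curve.HasTraversals). Shape copied from
Literature.Probability.Percolation.bondExploration_traversalBound (which is PROVED for percolation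
in InterfaceTraversalBound.lean). -/
@[route_item "route-CriticalPhenomena-SAWLeftRightFKG"]
def SAWTraversalBound : Prop :=
  ∀ (D : Literature.Probability.RandomPlanarGeometry.DobrushinDomain) (a b : ℝ → Literature.Probability.LatticeModels.Site 2), Literature.Probability.RandomPlanarGeometry.SAW.IsEndpointApprox D a b → ∃ (k : ℂ → ℝ → ℝ → ℕ) (K lam δ₀ : ℝ), 0 ≤ K ∧ 2 < lam ∧ 0 < δ₀ ∧ ∀ δ ∈ Set.Ioc (0 : ℝ) δ₀, ∀ (x : ℂ) (ρ R : ℝ), δ ≤ ρ → ρ < R → R ≤ 1 → Literature.Probability.RandomPlanarGeometry.SAW.law D.carrier δ (a δ) (b δ) {γ | (⟨γ.walk.toCurve (Literature.Probability.LatticeModels.meshPoint δ)⟩ : Literature.Probability.RandomPlanarGeometry.Curve ℂ).HasTraversals (k x ρ R) x ρ R} ≤ ENNReal.ofReal (K * (ρ / R) ^ lam)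

/-- item stmt-CriticalPhenomena-1881 · support · rank 9 · open · by planner
why it might fail: The repaired (eventual, event-level) form of the refuted stmt-CriticalPhenomena-0772; open for SAW, but implied by SAWTraversalBound via the proved AB criterion.
sources: Summit.CriticalPhenomena.SAWScalingLimit.Theorems.SAWParafermionTight_refuted (why the all-δ form is false; fix = eventual), Literature.Probability.RandomPlanarGeometry.IsTightAlongMesh (SLEConvergenceCriterion.lean), AizenmanBurchardDuke1999, KemppainenSmirnov2017
[support] EVENTUAL TIGHTNESS of the critical SAW laws: for every Dobrushin domain and endpoint
approximation, IsTightAlongMesh (fun δ γ => γ.curve) (fun δ => SAW.law D δ a_δ b_δ) — for every ε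
some compact set of CurveClass ℂ carries all but ε of the mass for all small δ. This is the form the
Prokhorov criterion convergesInLawToSLE_of_isTightAlongMesh consumes and the repair of the refuted
all-δ Tight (IsTightLaws over δ ∈ (0,1]) suggested by the refuting theorem; offered to routes
SAWParafermion / SAWConfRestriction as their restated r3/r4. -/
@[route_item "route-CriticalPhenomena-SAWLeftRightFKG", crux]
def EventualTight : Prop :=
  ∀ (D : Literature.Probability.RandomPlanarGeometry.DobrushinDomain) (a b : ℝ → Literature.Probability.LatticeModels.Site 2), Literature.Probability.RandomPlanarGeometry.SAW.IsEndpointApprox D a b → Literature.Probability.RandomPlanarGeometry.IsTightAlongMesh (fun δ (γ : Literature.Probability.RandomPlanarGeometry.SAW.DomainSAW D.carrier δ (a δ) (b δ)) => γ.curve) (fun δ => Literature.Probability.RandomPlanarGeometry.SAW.law D.carrier δ (a δ) (b δ))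

/-- item stmt-CriticalPhenomena-1882 · support · rank 9 · closed · proved by Summit.CriticalPhenomena.SAWScalingLimit.Theorems.TraversalBoundTight_proof (prover) · by planner
sources: Literature.Probability.RandomPlanarGeometry.isTightMeasureSet_of_traversalBounds (PROVED, CurveTightness.lean), Literature.Probability.RandomPlanarGeometry.isTightAlongMesh_of_isTightMeasureSet_image (PROVED), Literature.Probability.Percolation.bondExploration_shortDistanceCutoff (H0 template), AizenmanBurchardDuke1999
[support] glue SAWTraversalBound → EventualTight by the tree's PROVED Aizenman–Burchard criterion
isTightMeasureSet_of_traversalBounds in E = ℂ with Λ = a closed ball containing D (d = 2,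
exists_finset_card_le_cover_closedBall), T = Ioc 0 δ₀, X_δ γ = the mesh polyline of γ (whose class
is γ.curve): (H0) short-distance cutoff — a SAW uses each lattice edge at most once and boundedly
many δ-edges meet closedBall x δ, so no shell of inner radius ≤ δ is traversed k₀ times (cf.
Percolation.bondExploration_shortDistanceCutoff); (H1) = SAWTraversalBound with threshold max k₀ (k
x ρ R); then isTightAlongMesh_of_isTightMeasureSet_image (a.e.-measurability is automatic, ⊤
σ-algebra: SAW.aemeasurable_curve). -/
@[route_item "route-CriticalPhenomena-SAWLeftRightFKG", crux]
def TraversalBoundTight : Prop :=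
  SAWTraversalBound → EventualTight

-- `TraversalBoundTight` holds: proved by `Summit.CriticalPhenomena.SAWScalingLimit.Theorems.TraversalBoundTight_proof` (its module imports this route file, so no `_holds` link can be stated here).

/-- item stmt-CriticalPhenomena-1885 · assembly · rank 1 · closed · proved by Summit.CriticalPhenomena.SAWScalingLimit.Theorems.sawLeftRightFKG_assembly_proof @ 7158ea267fb9 (prover) · by planner
sources: Literature.Probability.RandomPlanarGeometry.convergesInLawToSLE_of_isTightAlongMesh (PROVED), Literature.Probability.RandomPlanarGeometry.IsSLECurve.map_eq_holds (PROVED), Literature.Probability.RandomPlanarGeometry.SAW.aemeasurable_curve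
[assembly] LeftRightFKG → FKGToTraversalBound → TraversalBoundTight → SubseqIdentification →
SAWScalingLimit. Proof: h₂ h₁ : SAWTraversalBound (defeq), h₃ gives EventualTight; for each (D, a,
b) with IsEndpointApprox the laws SAW.law are probability measures for all small δ
(IsEndpointApprox.reachable ⇒ weight univ ≠ 0; finitely many SAWs in bounded Ω_δ ⇒ ≠ ∞), so replace
law by a probability-valued family agreeing eventually (ConvergesInLawToSLE, IsTightAlongMesh and
IsSubseqLimitLaw only see the germ at 0+), apply convergesInLawToSLE_of_isTightAlongMesh with huniq
:= IsSLECurve.map_eq_holds, hY := eventually SAW.aemeasurable_curve, hT := EventualTight, hL :=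
SubseqIdentification read through IsSubseqLimitLaw, and unfold SAWScalingLimit =
Literature.Probability.RandomPlanarGeometry.SAW.SAWScalingLimit. -/
@[route_item "route-CriticalPhenomena-SAWLeftRightFKG", crux]
def Assembly : Prop :=
  LeftRightFKG → FKGToTraversalBound → TraversalBoundTight → SubseqIdentification → SAWScalingLimit

-- `Assembly` holds: proved by `Summit.CriticalPhenomena.SAWScalingLimit.Theorems.sawLeftRightFKG_assembly_proof` @ 7158ea267fb9 (its module imports this route file, so no `_holds` link can be stated here).

/-! D-0027 §2.1 — DECIDING THEOREM (planner-authored via `route open/edit --closes-file`; by planner-rbadge-CriticalPhenomena-SAWLeftRightF-72cbc6df-g4-0 2026-08-15T16:53:58Z):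
its hypotheses are this route's items and its conclusion the sub-problem Statement (glue_lint), and it elaborates with this file. -/

@[closes "route-CriticalPhenomena-SAWLeftRightFKG"] theorem closes (h₁ : LeftRightFKG) (h₂ : FKGToTraversalBound) (h₃ : TraversalBoundTight) (h₄ : SubseqIdentification) (hA : Assembly) : _root_.SAWScalingLimit :=
  hA h₁ h₂ h₃ h₄

end Summit.CriticalPhenomena.SAWScalingLimit.Theses.SAWLeftRightFKG
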